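import Summits.BirchSwinnertonDyer.BirchSwinnertonDyer.Theorems.KimAtThreeD7uTamagawaLevel
import Summits.BirchSwinnertonDyer.BirchSwinnertonDyer.Theorems.KimAtThreeD7uTamagawaIndexCocycles
import HarnessLib

/-!
# The TAMAGAWA-DIVISIBLE bad places, VII: the POSITIVE-EXPONENT Tamagawa index
# `#𝓕_can(w)_k = #𝓕_u(w)_k · #Φ_w[p^{k+1}]` on `E[p^{k+1}]` at every finite `w ∤ p` of `ℚ`
# (cell `bsd-addord`, seat w2-tamdiv gen 4; route W2 `KimAtThreeKolyvagin`, items 19562 / 19560, «TamDiv∞»)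

HONEST FRAMING: TOOL theorem (no definition, no named fact, no `sorry`); closes nothing by itself;
nothing is booked; BSD is not proved by any of this.  Seat gens 2/3 landed [MR04] Remark A.5 for `T_pE`
(Kato-type classes are Kolyvagin systems for `𝓕_u = blochKatoSelmerStructure p (tateTorsionDatum W p k) ⊤`,
`𝓕_u ≤ 𝓕_can`) and the exponent-ZERO Tamagawa index (`p ∤ c_w ⇒ 𝓕_u(w) = 𝓕_can(w)`,
`KimAtThreeD7uTamagawaFreeStructures`).  This file proves the E-SPECIFIC positive-exponent index named as
the honest limit by gen 3 and by acc5 g3 (`KimAtThreeDeepUpperOffStratumLocalIndex`: «the E-specific order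
`#H¹(I_w, T_pE)^{Fr} = (c_w)_p` is NOT here»), in TORSION currency, for EVERY reduction type and EVERY prime
`p` with `w ∤ p` (no Lang, no Tate uniformisation, no `p > 3`):

**`natCard_propagatedSelmerStructure_inr_eq_mul`**:
  `#𝓕_can(w)_k = #𝓕_u(w)_k · #Φ_w[p^{k+1}]`,
where `𝓕_can(w)_k = propagatedSelmerStructure W p k (Sum.inr w)` (Mazur–Rubin's canonical condition on
`E[p^k · p]`), `𝓕_u(w)_k = blochKatoSelmerStructure p (tateTorsionDatum W p k) L (Sum.inr w)` ([MR04] Rem. A.5's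
unramified condition), and `Φ_w = X(ℚ_w)/X₀(ℚ_w)` is the component group of the minimal model at `w`
(`X₀ = nonsingularReductionSubgroup`; `#Φ_w = c_w = localTamagawaNumber`,
`localTamagawaNumber_eq_index_nonsingularReductionSubgroup`).  This is Rubin, *Euler Systems*, Lemma 1.3.5 /
Büyükboduk, JNT 129 (2009) §2.1.2 Remark 2 («the order of `H⁰(ℚ_ℓ, W^{I_ℓ}/(V^{I_ℓ}/T^{I_ℓ}))` is the
`p`-part of the Tamagawa number at `ℓ`») at finite level, and the local sentence of [MR04] Prop. 6.2.6
(«`H¹_{𝓕_u}(ℚ_ℓ, E[p])` is strictly smaller than `H¹_{𝓕_can}(ℚ_ℓ, E[p])` when `p ∣ c_ℓ`») — there obtained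
for `p > 3` from «`p ∣ c_ℓ ⇒` split multiplicative», here for all types (including IV, IV* with `c = 3`).

PROOF (parts I–VI of this series): with `φ` a Frobenius lift, `F = E[p^{k+1}]^{I_w}`, `S = π_{k+1}(T_pE^{I_w})
= F ∩ core` (part I): unramified classes ↔ values at `φ` modulo `(φ−1)F` (part V), so for the value map
`f : F → H¹(ℚ_w, E[p^{k+1}])`, `ker f = (φ−1)F`, `f(S) = 𝓕_u(w)` (part V) and `#f(F) = #F^{φ} = #E(ℚ_w)[p^{k+1}]
= #𝓕_can(w)` (part V); `#f(F) = #f(S) · [F : S + (φ−1)F]` and `[F : S + (φ−1)F] = [{x : (φ−1)x ∈ S} : S]`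
(part VI §0) `= #Φ_w[p^{k+1}]` (part VI §2, from parts II–IV).

Corollaries (`KimAtThreeD7uTamagawaIndexCorollaries`): `p ∣ c_w ⇒ 𝓕_u(w)_k ⊊ 𝓕_can(w)_k` for every `k`;
`𝓕_u(w)_k = 𝓕_can(w)_k ↔ p ∤ c_w`; `p^{v_p(c_w)} ∣ p^{k+1} ⇒ [𝓕_can(w) : 𝓕_u(w)] = p^{v_p(c_w)}`.
References: K. Rubin, *Euler Systems* (2000) Lemma 1.3.2, 1.3.5; K. Büyükboduk, JNT 129 (2009) §2.1.2
Remark 2, Thm. 3.1; B. Mazur, K. Rubin, Mem. AMS 799 (2004) Prop. 6.2.6, App. A Remark A.5; A. Grothendieck,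
SGA 7 I, Exp. IX §11; J. S. Milne, *ADT* I Lemma 3.3, Prop. 3.8.
-/

noncomputable section

-- the cell's Theorems namespace `Summit.BirchSwinnertonDyer.BirchSwinnertonDyer.…` repeats the summit name by design (D-0017)
set_option linter.dupNamespace false

open CategoryTheory Function Field IsDedekindDomain NumberField
open scoped NumberField Classical
open Literature.NumberTheory.GaloisRepresentations Literature.NumberTheory.EllipticCurves
open Literature.NumberTheory.GaloisRepresentations.IsNonarchimedeanLocalField
open WeierstrassCurve
open Summit.BirchSwinnertonDyer.Rank1Residual.GaloisImage
open Summit.BirchSwinnertonDyer.Rank1Residual.GaloisImage.InertiaDivisible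
open Summit.BirchSwinnertonDyer.Rank1Residual.GaloisImage.Derivative.Transverse.Rat
open Summit.BirchSwinnertonDyer.BirchSwinnertonDyer.Theorems.KimAtThreeD7uTamagawaCore
open Summit.BirchSwinnertonDyer.BirchSwinnertonDyer.Theorems.KimAtThreeD7uTamagawaLevel

namespace Summit.BirchSwinnertonDyer.BirchSwinnertonDyer.Theorems.KimAtThreeD7uTamagawaIndex

variable (W : WeierstrassCurve ℚ) [W.IsElliptic] (p : ℕ) [hp : Fact p.Prime] (k : ℕ)
  (w : HeightOneSpectrum (𝓞 ℚ))

/-- Local notation: `T_pE|_{Γ_{ℚ_w}}` (= `tateLocalRep W p (Sum.inr w)`, by `rfl`). -/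
local notation3 "𝕋" => (GaloisRep.restrictField (HeightOneSpectrum.adicCompletion ℚ w)
  (WeierstrassCurve.tateGaloisRep W p (W.continuous_galoisRepTate_holds p)).toIntRep)
/-- Local notation: `E[p^k · p]|_{Γ_{ℚ_w}}` (= `(W.torsionGaloisModule (p^k · p)).toLocal (Sum.inr w)`). -/
local notation3 "𝕄" => (GaloisRep.restrictField (HeightOneSpectrum.adicCompletion ℚ w)
  (W.torsionGaloisModule ((p : ℤ) ^ k * (p : ℤ))))

/-- **The positive-exponent Tamagawa index** (Rubin, *Euler Systems*, Lemma 1.3.5; Büyükboduk 2009 §2.1.2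
Remark 2; the local sentence of [MR04] Prop. 6.2.6 — for every reduction type and every `p` with `w ∤ p`):
on `E[p^k · p]` at a finite place `w ∤ p` of `ℚ`,
`#𝓕_can(w)_k = #𝓕_u(w)_k · #Φ_w[p^{k+1}]`, `Φ_w = X(ℚ_w)/X₀(ℚ_w)` the component group of the minimal model
(`#Φ_w = c_w`).  See the module docstring for the proof through parts I–VI.
[cite: Rubin2000, Lemma 1.3.5] [cite: MazurRubin2004, Prop. 6.2.6 and App. A Remark A.5 (p. 81)] -/
theorem natCard_propagatedSelmerStructure_inr_eq_mul (hw : ((p : ℕ) : 𝓞 ℚ) ∉ w.asIdeal)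
    (L : (tateTorsionDatum W p k).LocalConditionsAbove p) :
    Nat.card (propagatedSelmerStructure W p k (Sum.inr w)) =
      Nat.card (blochKatoSelmerStructure p (tateTorsionDatum W p k) L (Sum.inr w)) *
        Nat.card (AddSubgroup.torsionBy
          (((W.localMinimalIntegralModel w).baseChange (w.adicCompletion ℚ)).toAffine.Point ⧸
            (W.localMinimalIntegralModel w).nonsingularReductionSubgroup
              (integers_valuationRing_valuation (w.adicCompletionIntegers ℚ) (w.adicCompletion ℚ)))
          (p ^ (k + 1) : ℕ)) := by
  have hpp : p.Prime := hp.out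
  set F := w.adicCompletion ℚ with hFdef
  set θ : absoluteGaloisGroup F →ₜ* absoluteGaloisGroup ℚ := absGaloisRestrict ℚ F with hθdef
  set 𝔓₀ : Ideal (absIntegers (𝓞 ℚ) ℚ) := adicCompletionPrime ℚ w with h𝔓₀def
  set I : Subgroup (absoluteGaloisGroup ℚ) := 𝔓₀.inertia (absoluteGaloisGroup ℚ) with hIdef
  set Dv : Subgroup (absoluteGaloisGroup ℚ) := 𝔓₀.decompositionSubgroup (absoluteGaloisGroup ℚ)
    with hDvdef
  haveI : (absInertia F).Normal := absInertia_normal_holds F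
  have hIeq : I = (absInertia F).map θ.toMonoidHom := by
    rw [hIdef, h𝔓₀def, inertia_adicCompletionPrime_eq_map_absInertia]
  have hθI : ∀ u : absInertia F, θ u ∈ I := fun u => by
    rw [hIeq]; exact Subgroup.mem_map_of_mem _ u.2
  have hθD : ∀ σ : absoluteGaloisGroup F, θ σ ∈ Dv := fun σ => by
    rw [hDvdef, h𝔓₀def, decompositionSubgroup_adicCompletionPrime_eq_range]; exact ⟨σ, rfl⟩
  obtain ⟨φ, hφ⟩ := exists_isFrobPow_holds (F := F) 1
  have hφ' : IsArithFrobAt (𝓞 ℚ) (θ φ) 𝔓₀ := isArithFrobAt_absGaloisRestrict_of_isFrobPow_one w hφ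
  have hφD : θ φ ∈ Dv := hφ'.mem_stabilizer
  -- the torsion modules
  have hn0 : ((p : ℤ) ^ k * (p : ℤ)) ≠ 0 := by
    have : (p : ℤ) ≠ 0 := by exact_mod_cast hpp.ne_zero
    exact mul_ne_zero (pow_ne_zero _ this) this
  haveI : Finite (geomTorsion W ((p : ℤ) ^ k * (p : ℤ))) := finite_torsionPoints_holds W (AlgebraicClosure ℚ) hn0
  let Mt := geomTorsion W ((p : ℤ) ^ k * (p : ℤ))
  let Tor := W.geomPrimaryTorsion p
  have hpow : ∀ P : geomPoints W, P ∈ geomTorsion W ((p : ℤ) ^ k * (p : ℤ)) → p ^ (k + 1) • P = 0 :=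
    fun P hP => by
      have h := (mem_geomTorsion_pow_mul_iff W p k P).mp hP
      rwa [mem_geomTorsion_iff, natCast_zsmul] at h
  have hprim : ∀ P : geomPoints W, P ∈ geomTorsion W ((p : ℤ) ^ k * (p : ℤ)) → P ∈ Tor :=
    fun P hP => (AddCommGroup.mem_primaryComponent).mpr ⟨k + 1, hpow P hP⟩
  have hmemMt : ∀ x : Tor, p ^ (k + 1) • x = 0 → (x : geomPoints W) ∈ geomTorsion W ((p : ℤ) ^ k * (p : ℤ)) :=
    fun x hx => by
      rw [mem_geomTorsion_pow_mul_iff, mem_geomTorsion_iff, natCast_zsmul]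
      have h := congrArg (fun z : Tor => (z : geomPoints W)) hx
      simpa only [AddSubmonoidClass.coe_nsmul, ZeroMemClass.coe_zero] using h
  -- `ι : E[p^k·p] → E[p^∞]`
  let ι : Mt → Tor := fun m => ⟨(m : geomPoints W), hprim _ m.2⟩
  have hι : ∀ m : Mt, ((ι m : Tor) : geomPoints W) = (m : geomPoints W) := fun _ => rfl
  have hι_add : ∀ a b : Mt, ι (a + b) = ι a + ι b := fun _ _ => Subtype.ext rfl
  have hι_sub : ∀ a b : Mt, ι (a - b) = ι a - ι b := fun _ _ => Subtype.ext rfl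
  have hι_smul : ∀ (σ : absoluteGaloisGroup F) (m : Mt),
      ι ((DiscreteGaloisModule.toTopRep 𝕄).ρ σ m) = θ σ • ι m := fun _ _ => Subtype.ext rfl
  have hι_inj : ∀ a b : Mt, ι a = ι b → a = b := fun a b h =>
    Subtype.ext (congrArg (fun z : Tor => (z : geomPoints W)) h)
  have hιpow : ∀ m : Mt, p ^ (k + 1) • ι m = 0 := fun m =>
    Subtype.ext (by rw [AddSubmonoidClass.coe_nsmul, ZeroMemClass.coe_zero]; exact hpow _ m.2)
  -- the core predicate on `E[p^∞]` and `I`-fixedness in the two currencies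
  let P : Tor → Prop := fun x => ∀ j : ℕ, ∃ y : Tor, (∀ i ∈ I, i • y = y) ∧ p ^ j • y = x
  have hfixI : ∀ m : Mt, (∀ u : absInertia F, (DiscreteGaloisModule.toTopRep 𝕄).ρ
      (u : absoluteGaloisGroup F) m = m) ↔ ∀ i ∈ I, i • ι m = ι m := by
    intro m
    constructor
    · intro h i hi
      rw [hIeq] at hi
      obtain ⟨u, hu, rfl⟩ := Subgroup.mem_map.mp hi
      have := congrArg ι (h ⟨u, hu⟩)
      rwa [hι_smul] at this
    · intro h u
      apply hι_inj
      rw [hι_smul]; exact h _ (hθI u)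
  -- `G = E[p^k·p]^{I_w}`
  let G : AddSubgroup Mt :=
    { carrier := {m | ∀ u : absInertia F,
        (DiscreteGaloisModule.toTopRep 𝕄).ρ (u : absoluteGaloisGroup F) m = m}
      add_mem' := fun {a b} ha hb u ↦ by rw [map_add, ha u, hb u]
      zero_mem' := fun u ↦ map_zero _
      neg_mem' := fun {a} ha u ↦ by rw [map_neg, ha u] }
  have hGmem : ∀ m : Mt, m ∈ G ↔ ∀ u : absInertia F,
      (DiscreteGaloisModule.toTopRep 𝕄).ρ (u : absoluteGaloisGroup F) m = m := fun _ ↦ Iff.rfl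
  haveI : Finite G := inferInstance
  -- `φ` preserves `G`; `ψ₀ = φ − 1` on `G`
  have hφG : ∀ m : Mt, m ∈ G → (DiscreteGaloisModule.toTopRep 𝕄).ρ φ m ∈ G := by
    intro m hm u
    have hu' : φ⁻¹ * (u : absoluteGaloisGroup F) * φ ∈ absInertia F := by
      have := Subgroup.Normal.conj_mem inferInstance (u : absoluteGaloisGroup F) u.2 φ⁻¹
      rwa [inv_inv] at this
    have e : (DiscreteGaloisModule.toTopRep 𝕄).ρ (u : absoluteGaloisGroup F)
        ((DiscreteGaloisModule.toTopRep 𝕄).ρ φ m) =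
        (DiscreteGaloisModule.toTopRep 𝕄).ρ φ ((DiscreteGaloisModule.toTopRep 𝕄).ρ (φ⁻¹ * u * φ) m) := by
      have h1 : (DiscreteGaloisModule.toTopRep 𝕄).ρ ((u : absoluteGaloisGroup F) * φ) =
          (DiscreteGaloisModule.toTopRep 𝕄).ρ (φ * (φ⁻¹ * u * φ)) := by
        rw [← mul_assoc, ← mul_assoc, mul_inv_cancel, one_mul]
      have h2 := DFunLike.congr_fun h1 m
      rw [map_mul, map_mul] at h2
      exact h2
    rw [e, hm ⟨_, hu'⟩]
  let ψ₀ : G →+ G :=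
    { toFun := fun m ↦ ⟨(DiscreteGaloisModule.toTopRep 𝕄).ρ φ m - m, G.sub_mem (hφG _ m.2) m.2⟩
      map_zero' := Subtype.ext (by simp)
      map_add' := fun a b ↦ Subtype.ext (by
        simp only [AddSubgroup.coe_add, map_add, AddMemClass.mk_add_mk]; abel) }
  have hψ₀ : ∀ m : G, ((ψ₀ m : G) : Mt) = (DiscreteGaloisModule.toTopRep 𝕄).ρ φ m - m := fun _ ↦ rfl
  -- `S = G ∩ core`
  let S : AddSubgroup G :=
    { carrier := {m | P (ι m)}
      add_mem' := fun {a b} ha hb ↦ by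
        change P (ι ((a : Mt) + b)); rw [hι_add]; exact core_add W p ha hb
      zero_mem' := by change P (ι (0 : Mt)); exact core_zero W p
      neg_mem' := fun {a} ha ↦ by
        change P (ι (-(a : Mt)))
        have e : ι (-(a : Mt)) = -ι a := Subtype.ext rfl
        rw [e]; exact core_neg W p ha }
  have hSmem : ∀ m : G, m ∈ S ↔ P (ι m) := fun _ ↦ Iff.rfl
  have hψ₀S : ∀ m ∈ S, ψ₀ m ∈ S := fun m hm ↦ by
    rw [hSmem, hψ₀, hι_sub, hι_smul]
    exact core_sub W p (core_smul_of_mem_decompositionSubgroup W p hm hφD) hm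
  -- the value map `f : G → H¹(ℚ_w, E[p^k·p])` (a cocycle vanishing on `I_w` with prescribed `φ`-value)
  choose ψc hψcI hψcφ using fun m : G ↦
    exists_cocycle_vanishing_inertia_apply_eq W p k w hφ (m := (m : Mt)) m.2
  have hclass : ∀ (z z' : contOneCocycles (DiscreteGaloisModule.toTopRep 𝕄)),
      (∀ u : absInertia F, z.1 u = 0) → (∀ u : absInertia F, z'.1 u = 0) → z.1 φ = z'.1 φ →
      oneCocycleClass _ z = oneCocycleClass _ z' := by
    intro z z' hz hz' hval
    exact (oneCocycleClass_eq_iff_of_vanishing_inertia W p k w hφ z z' hz hz').mpr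
      ⟨0, fun u ↦ map_zero _, by rw [hval, sub_self, map_zero, sub_zero]⟩
  -- the zero criterion for `I_w`-vanishing cocycles, read in `galoisCohomology`
  have hzero : ∀ z : contOneCocycles (DiscreteGaloisModule.toTopRep 𝕄),
      (∀ u : absInertia F, z.1 u = 0) →
      ((oneCocycleClass (DiscreteGaloisModule.toTopRep 𝕄) z :
          galoisCohomology ((W.torsionGaloisModule ((p : ℤ) ^ k * (p : ℤ))).toLocal (Sum.inr w)) 1) = 0 ↔
        ∃ v : Mt, (∀ u : absInertia F,
          (DiscreteGaloisModule.toTopRep 𝕄).ρ (u : absoluteGaloisGroup F) v = v) ∧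
          z.1 φ = (DiscreteGaloisModule.toTopRep 𝕄).ρ φ v - v) := fun z hz ↦
    oneCocycleClass_eq_zero_iff_of_vanishing_absInertia (w.adicCompletion ℚ)
      (DiscreteGaloisModule.toTopRep 𝕄) (𝕄).continuous_smul hφ z hz
  let f : G →+ galoisCohomology ((W.torsionGaloisModule ((p : ℤ) ^ k * (p : ℤ))).toLocal (Sum.inr w)) 1 :=
    { toFun := fun m ↦ oneCocycleClass (DiscreteGaloisModule.toTopRep 𝕄) (ψc m)
      map_zero' := (hzero _ (hψcI 0)).mpr ⟨0, fun u ↦ map_zero _, by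
        rw [hψcφ, map_zero, sub_zero]; rfl⟩
      map_add' := fun a b ↦ by
        refine (hclass _ _ (hψcI _) (fun u ↦ ?_) ?_).trans
          (oneCocycleClass_add (DiscreteGaloisModule.toTopRep 𝕄) (ψc a) (ψc b))
        · change (ψc a).1 u + (ψc b).1 u = 0
          rw [hψcI a u, hψcI b u, add_zero]
        · change (ψc (a + b)).1 φ = (ψc a).1 φ + (ψc b).1 φ
          rw [hψcφ, hψcφ, hψcφ]; rfl }
  have hf : ∀ m : G, f m = oneCocycleClass (DiscreteGaloisModule.toTopRep 𝕄) (ψc m) := fun _ ↦ rfl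
  -- (C1) `ker f = (φ − 1)G`
  have hker : f.ker = ψ₀.range := by
    ext m
    rw [AddMonoidHom.mem_ker, hf]
    refine (hzero (ψc m) (hψcI m)).trans ?_
    rw [hψcφ]
    constructor
    · rintro ⟨v, hv, hmv⟩
      refine ⟨⟨v, hv⟩, Subtype.ext ?_⟩
      rw [hψ₀]
      exact hmv.symm
    · rintro ⟨v, hv⟩
      refine ⟨(v : Mt), v.2, ?_⟩
      rw [← hv, hψ₀]
  -- (C2) `f(S) = 𝓕_u(w)`
  have hmapS : S.map f = blochKatoSelmerStructure p (tateTorsionDatum W p k) L (Sum.inr w) := by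
    ext x
    rw [AddSubgroup.mem_map]
    refine Iff.trans ?_ (mem_blochKatoSelmerStructure_inr_iff_exists_cocycle W p k w L hw hφ x).symm
    constructor
    · rintro ⟨m, hm, rfl⟩
      -- `ι m = π_{k+1}(a)` for an `I`-fixed Tate vector `a`
      obtain ⟨a, haI, ha⟩ := exists_tate_proj_eq_of_core W p ((hSmem m).mp hm) (hιpow (m : Mt))
      refine ⟨ψc m, hψcI m, ⟨a, fun u ↦ ?_, ?_⟩, rfl⟩
      · change (θ u) • a = a; exact haI _ (hθI u)
      · rw [hψcφ]
        exact ha.symm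
    · rintro ⟨ψ, hψI, ⟨a, haI, hψa⟩, rfl⟩
      have haI' : ∀ i ∈ I, i • a = a := by
        intro i hi
        rw [hIeq] at hi
        obtain ⟨u, hu, rfl⟩ := Subgroup.mem_map.mp hi
        exact haI ⟨u, hu⟩
      -- `m = ψ(φ)` is `I_w`-fixed and its image in `E[p^∞]` is the core point `π_{k+1}(a)`
      let m : Mt := ψ.1 φ
      have hmG : m ∈ G := fun u ↦ apply_mem_invariants_of_vanishing (DiscreteGaloisModule.toTopRep 𝕄) ψ hψI φ u
      have hιm : ι m = ⟨TateModule.proj p (k + 1) a,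
          (AddCommGroup.mem_primaryComponent).mpr ⟨k + 1, TateModule.pow_smul_proj (k + 1) a⟩⟩ :=
        Subtype.ext hψa
      have hmS : (⟨m, hmG⟩ : G) ∈ S := by
        rw [hSmem]
        change P (ι m)
        rw [hιm]
        exact core_proj_of_inertia_smul_eq W p a haI' (k + 1)
      refine ⟨⟨m, hmG⟩, hmS, ?_⟩
      rw [hf]
      exact hclass _ _ (hψcI _) hψI (by rw [hψcφ])
  -- (C3) `#f(G) = #ker ψ₀ = #E[p^k·p]^{Γ_{ℚ_w}} = #𝓕_can(w)`
  haveI : Nonempty ψ₀.range := ⟨0⟩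
  have hrange : Nat.card f.range = Nat.card ψ₀.ker := by
    rw [← AddSubgroup.index_ker, hker]
    have h1 : ψ₀.range.index * Nat.card ψ₀.range = Nat.card G := AddSubgroup.index_mul_card _
    have h2 : Nat.card G = Nat.card ψ₀.ker * Nat.card ψ₀.range := by
      rw [← Nat.card_congr (QuotientAddGroup.quotientKerEquivRange ψ₀).toEquiv, mul_comm]
      exact AddSubgroup.card_eq_card_quotient_mul_card_addSubgroup ψ₀.ker
    exact Nat.eq_of_mul_eq_mul_right (Nat.card_pos (α := ψ₀.range)) (h1.trans h2)
  have hinv : Nat.card ψ₀.ker = Nat.card (DiscreteGaloisModule.toTopRep 𝕄).ρ.invariants := by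
    refine Nat.card_congr ?_
    have hto : ∀ m : ψ₀.ker, ((m : G) : Mt) ∈ (DiscreteGaloisModule.toTopRep 𝕄).ρ.invariants := by
      intro m
      refine (Representation.mem_invariants _ _).mpr fun σ ↦ ?_
      have hφm : (DiscreteGaloisModule.toTopRep 𝕄).ρ φ ((m : G) : Mt) = ((m : G) : Mt) := by
        have h := congrArg (fun z : G ↦ (z : Mt)) ((AddMonoidHom.mem_ker).mp m.2)
        rw [hψ₀, ZeroMemClass.coe_zero] at h
        exact sub_eq_zero.mp h
      apply hι_inj
      change θ σ • ι ((m : G) : Mt) = ι ((m : G) : Mt)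
      refine smul_eq_of_mem_decompositionSubgroup_of_inertia_of_frob W p w hφ'
        ((hfixI _).mp (m : G).2) ?_ (hθD σ)
      have := congrArg ι hφm
      rwa [hι_smul] at this
    exact
      { toFun := fun m ↦ ⟨((m : G) : Mt), hto m⟩
        invFun := fun m ↦ ⟨⟨(m : Mt), fun u ↦ (Representation.mem_invariants _ _).mp m.2 _⟩,
          (AddMonoidHom.mem_ker).mpr (Subtype.ext (by
            rw [hψ₀, ZeroMemClass.coe_zero]
            exact sub_eq_zero.mpr ((Representation.mem_invariants _ _).mp m.2 φ)))⟩
        left_inv := fun m ↦ rfl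
        right_inv := fun m ↦ rfl }
  -- (C4) the index `[G : S + ker f]` through part VI
  have hS0 : Nat.card S ≠ 0 := by
    haveI : Nonempty S := ⟨0⟩
    exact (Nat.card_pos (α := S)).ne'
  have hrel : S.relIndex (S.comap ψ₀) = Nat.card (AddSubgroup.torsionBy
      (((W.localMinimalIntegralModel w).baseChange (w.adicCompletion ℚ)).toAffine.Point ⧸
        (W.localMinimalIntegralModel w).nonsingularReductionSubgroup
          (integers_valuationRing_valuation (w.adicCompletionIntegers ℚ) (w.adicCompletion ℚ)))
      (p ^ (k + 1) : ℕ)) := by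
    have hle : S ≤ S.comap ψ₀ := fun m hm ↦ by rw [AddSubgroup.mem_comap]; exact hψ₀S m hm
    -- `[ψ₀⁻¹(S) : S] · #S = #ψ₀⁻¹(S)`
    have h1 : S.relIndex (S.comap ψ₀) * Nat.card S = Nat.card (S.comap ψ₀) := by
      rw [← Nat.card_congr (AddSubgroup.addSubgroupOfEquivOfLe hle).toEquiv]
      exact AddSubgroup.index_mul_card (S.addSubgroupOf (S.comap ψ₀))
    -- the two sets of part VI
    have e1 : Nat.card (S.comap ψ₀) = Nat.card {x : Tor //
        (∀ i ∈ I, i • x = x) ∧ p ^ (k + 1) • x = 0 ∧ P ((θ φ) • x - x)} := by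
      refine Nat.card_congr ?_
      exact
        { toFun := fun m ↦ ⟨ι ((m : G) : Mt), (hfixI _).mp (m : G).2, hιpow _, by
            have h := m.2
            rw [AddSubgroup.mem_comap, hSmem, hψ₀, hι_sub, hι_smul] at h
            exact h⟩
          invFun := fun x ↦ ⟨⟨⟨(x.1 : geomPoints W), hmemMt x.1 x.2.2.1⟩,
              (hfixI _).mpr (by exact x.2.1)⟩, by
            rw [AddSubgroup.mem_comap, hSmem, hψ₀, hι_sub, hι_smul]
            exact x.2.2.2⟩
          left_inv := fun m ↦ rfl
          right_inv := fun x ↦ rfl }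
    have e2 : Nat.card S = Nat.card {x : Tor //
        (∀ i ∈ I, i • x = x) ∧ p ^ (k + 1) • x = 0 ∧ P x} := by
      refine Nat.card_congr ?_
      exact
        { toFun := fun m ↦ ⟨ι ((m : G) : Mt), (hfixI _).mp (m : G).2, hιpow _, m.2⟩
          invFun := fun x ↦ ⟨⟨⟨(x.1 : geomPoints W), hmemMt x.1 x.2.2.1⟩,
              (hfixI _).mpr (by exact x.2.1)⟩, by exact x.2.2.2⟩
          left_inv := fun m ↦ rfl
          right_inv := fun x ↦ rfl }
    have h2 := natCard_level_frobSub_core_eq W p hw hφ' (k + 1)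
    rw [← e1, ← e2] at h2
    rw [h2, mul_comm] at h1
    exact Nat.eq_of_mul_eq_mul_left (Nat.pos_of_ne_zero hS0) h1
  -- assembly
  rw [natCard_propagatedSelmerStructure_inr_eq_natCard_invariants W p k w hw, ← hinv, ← hrange,
    natCard_range_eq_natCard_map_mul_index f S, hmapS, hker,
    index_sup_range_eq_relIndex_comap ψ₀ S hψ₀S, hrel]
  rfl

end Summit.BirchSwinnertonDyer.BirchSwinnertonDyer.Theorems.KimAtThreeD7uTamagawaIndex

end
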